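import Summits.HodgeConjecture.HodgeConjecture.Theorems.F0LD1ThetaGermDefs
import Summits.HodgeConjecture.HodgeConjecture.Theorems.F0LD1CharSeamOfMeets
import Summits.HodgeConjecture.HodgeConjecture.Theorems.F0LD1CharThetaSpaceLeOfIrreducible
import Summits.HodgeConjecture.HodgeConjecture.Theorems.HLiu418S1BettiSliceExclusion
import Literature.NumberTheory.Automorphic.Liu2021.ThetaLiftFromLineIrreducible
import Literature.NumberTheory.Rogawski1990.CurveThetaCohFinComponentUnique
import HarnessLib

-- As in the lineage (★ `F0LD1ThetaCharRigidOfIrred`): statements over the theta-kernel datum elaborate to very large types; elaborate sequentially.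
set_option Elab.async false

/-!
# Crux `HLiu418`, line LD1 — THE CLOSER OF ORGAN (I) `stub_thetaCharRigid : ThetaCharRigid₂` FROM THE SUB-ORGAN (Gα) `ThetaDichotomy₂` ALONE
# (no (D), no (Gβ), no letter (I′); theorems only)

Cell `hodgecm-mathlib` (D-0151), FLOOR 0, half A line LD1 (socket `stub_S1_facts`, #73; leaf `Cruxes/HLiu418/Lines/F0_P6LD_StubS1FactsThetaRoad.lean` ED. 4, ED. 5∕6 to come),
dealer LD1-plan (g2) DEALS #3 plate «ORGAN-(I)-OF-DICHOTOMY», seat LD1-p01 (g2), 2026-09-02.  THEOREMS ONLY; `--supports stmt-HodgeConjecture-24832`.  Pattern and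
conclusion tokens = ★ `F0LD1ThetaCharRigidOfIrred.thetaCharRigid₂_of_irred` (LD1-p01 (g0)); proof = LD1-plan (g2)'s probe
`F0/P6/LD/LD1-plan/g2/ThetaCharRigidOfDichotomy.probe.v1.LD1-plan-g2.lean` (sha16 10992b4fc7a60b3a, GREEN TRIO, tie `rfl` against the leaf) §I verbatim with the class set
read from ★ `F0LD1ThetaGermDefs` (p850501).

THE STATEMENT **`thetaCharRigid₂_of_dichotomy (hα : F0LD1ThetaGermDefs.ThetaDichotomy₂) : ‹ThetaCharRigid₂ BY VALUE›`**: over the CM curve frames of line LD1, if a discrete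
`P ⊂ L²([U(H)], μ)` MEETS the theta lift from the line `⟨a′⟩` at `λ` along the pinned transport `ιA`, then for some character `ξ` of `[U(⟨a′⟩)]` EVERY `(a′, ξ)`-theta class lies
in `P` and one of them is non-zero (the conclusion of ★ `thetaCharRigid₂_of_irred` verbatim = the leaf's `ThetaCharRigid₂` with `CharThetaSpaceLe₂` ∕ `CharSeam₂` unfolded).
PROOF: `[U(H)]` compact (★ `S1BettiSliceExclusion.anisotropic_of_formCongr_posDef`, ★ `compactSpace_adelicGroupData_automorphicQuotient`); the seam (I-B) ★
`F0LD1CharSeamOfMeets.charSeam_of_meets` gives `ξ` and a non-zero `(a′, ξ)`-theta class IN `P`; the DICHOTOMY (Gα) at `Q := P.space`: either the span of all `(a′, ξ)`-theta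
classes lies in `P` (done, ★ `Submodule.subset_span`), or it meets `P` in `0` — refuted by the seam class.  So organ (I) rests on (Gα) ONLY; (Gα) is strictly weaker than
the letter (I′) (LD1-plan (g2) 08:32Z; LD-ref1 (g2) C1).

HONEST LABEL.  Nothing printed is discharged here ((Gα) carries the Howe-duality content); HC_CM is proved only modulo the 7 printed citations (2 remaining: hLiu418 =
stmt-HodgeConjecture-24832, h413 = stmt-HodgeConjecture-24833) until rung 0 closes; count-neutral.

References: [Liu2021] Y. Liu, Camb. J. Math. 9 (2021), App. B Cor. B.6 (1) p. 99, proof of Prop. 4.13 Case 1 p. 48; [Rallis1984] §1; [Wu2013] Thm. 5.3; [Dixmier1977] §5.4.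
-/

set_option autoImplicit false
set_option linter.dupNamespace false

noncomputable section

open NumberField NumberField.InfinitePlace MeasureTheory IsDedekindDomain
open scoped Matrix Kronecker ComplexOrder ENNReal
open Literature.NumberTheory.Automorphic Literature.NumberTheory.Automorphic.UnitaryGroup
open Literature.NumberTheory.Automorphic.UnitaryGroup.CotangentForms
open Literature.NumberTheory.Automorphic.UnitaryCurveForms
open Literature.NumberTheory.Automorphic.IdeleClassGroup
open Literature.NumberTheory.Automorphic.Liu2021
open Literature.NumberTheory.Automorphic.Liu2021.Def411WeilCarriers
open Literature.NumberTheory.Automorphic.Liu2021.Def411WeilCarriersDoubling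
open Literature.NumberTheory.GaloisRepresentations
open Literature.NumberTheory.GelbartRogawski1991 Literature.NumberTheory.GelbartRogawski1991.UnitaryDualPair
open Literature.NumberTheory.GelbartRogawski1991.UnitaryDualPair.WeilCoinv
open Literature.NumberTheory.Weil1964
open Literature.RepresentationTheory.Liu2021 Literature.RepresentationTheory.HarrisKudlaSweet1996
open Literature.RepresentationTheory.CompactGroups
open Literature.RepresentationTheory.HeisenbergGroup
open Literature.NumberTheory.Rogawski1990
open Summit.HodgeConjecture.HodgeConjecture.Cruxes.HLiu418
open Summit.HodgeConjecture.HodgeConjecture.Cruxes.HLiu418.F0LD1ThetaGermDefs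

namespace Summit.HodgeConjecture.HodgeConjecture.Cruxes.HLiu418.F0LD1ThetaCharRigidOfDichotomy

set_option maxHeartbeats 1600000 in
-- (as in ★ `F0LD1ThetaCharRigidOfIrred`: the theta-kernel datum types are very large)
/-- **ORGAN (I) `ThetaCharRigid₂` FROM THE DICHOTOMY (Gα) ALONE** (conclusion = ★ `thetaCharRigid₂_of_irred`'s, verbatim): if a discrete `P` meets the theta lift from `⟨a′⟩`,
the seam (I-B) ★ `charSeam_of_meets` gives `ξ` and a non-zero `(a′, ξ)`-theta class IN `P`; the dichotomy `ThetaDichotomy₂` at `Q := P.space` then puts EVERY `(a′, ξ)`-theta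
class in `P` (the branch `span ⊓ P = ⊥` is refuted by the seam class).
[cite: Liu2021, proof of Prop. 4.13 Case 1 (p. 48); App. B Cor. B.6 (1) (p. 99)] [cite: Rallis1984, §1] -/
theorem thetaCharRigid₂_of_dichotomy (hα : ThetaDichotomy₂) :
    ∀ (L : Type) [Field L] [NumberField L] [IsCMField L] (ι : L →+* ℂ) (H : Matrix (Fin 2) (Fin 2) L)
      (dV : Fin 2 → L) (hdV : ∀ i, IsCMField.complexConj L (dV i) = dV i) (hdV0 : ∀ i, dV i ≠ 0)
      (t : L) (ht : t ≠ 0) (g : GL (Fin 2) L)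
      (_hg : formCongr ((IsCMField.complexConj L : L ≃ₐ[(↥(maximalRealSubfield L))] L) : L →+* L) g (t • H) = Matrix.diagonal dV),
      (∃ T : GL (Fin 2) ℂ, formCongr (starRingEnd ℂ) T ((Matrix.diagonal dV).map ι) = Matrix.diagonal ![(1 : ℂ), -1]) →
      (∀ τ' : L →+* ℂ, InfinitePlace.mk τ' ≠ InfinitePlace.mk ι → ((Matrix.diagonal dV).map τ').PosDef) →
      4 ≤ Module.finrank ℚ L →
      ∀ (μ : Measure (adelicGroupData (↥(maximalRealSubfield L)) L (IsCMField.complexConj L) 2 H).automorphicQuotient)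
        [(adelicGroupData (↥(maximalRealSubfield L)) L (IsCMField.complexConj L) 2 H).IsAutomorphicMeasure μ]
        {n' : ℕ} (e₁ : Fin 2 × Fin 1 ≃ Fin n')
        (lam : Literature.NumberTheory.Automorphic.IdeleClassGroup L →ₜ* Circle) (hlam : IsConjugateSymplectic L lam), HasWeight L lam 1 →
      ∀ (ιA : (adelicGroupData (↥(maximalRealSubfield L)) L (IsCMField.complexConj L) 2 H).Adelic →*
          ↥(UnitaryGroup.adelic (↥(maximalRealSubfield L)) L (IsCMField.complexConj L) 2 (Matrix.diagonal dV))),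
        (∀ k, ((ιA k : ↥(UnitaryGroup.adelic (↥(maximalRealSubfield L)) L (IsCMField.complexConj L) 2 (Matrix.diagonal dV))) :
              GL (Fin 2) (AdeleRing (𝓞 L) L)) =
            (toAdeleGL L g)⁻¹ * adelicVal (↥(maximalRealSubfield L)) L (IsCMField.complexConj L) 2 H k * toAdeleGL L g) →
      ∀ [CompactSpace (↥(UnitaryGroup.adelic (↥(maximalRealSubfield L)) L (IsCMField.complexConj L) 2 (Matrix.diagonal dV)) ⧸
          (UnitaryGroup.toAdelic (↥(maximalRealSubfield L)) L (IsCMField.complexConj L) 2 (Matrix.diagonal dV)).range)],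
      ∀ (P : DiscreteAutomorphicRep (adelicGroupData (↥(maximalRealSubfield L)) L (IsCMField.complexConj L) 2 H) μ)
        (a' : (↥(maximalRealSubfield L))ˣ),
        MeetsThetaLiftFromLine L 2 H e₁ dV hdV hdV0 P lam hlam a' ιA →
        ∃ ξ : (haveI := normal_range_toAdelic_JW L a'
          PontryaginDual (↥(UnitaryGroup.adelic (↥(maximalRealSubfield L)) L (IsCMField.complexConj L) 1 (JW (↥(maximalRealSubfield L)) L a')) ⧸ (UnitaryGroup.toAdelic (↥(maximalRealSubfield L)) L (IsCMField.complexConj L) 1 (JW (↥(maximalRealSubfield L)) L a')).range)),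
        ( -- `CharThetaSpaceLe₂ L H e₁ dV hdV hdV0 P lam hlam a' ιA ξ` BY VALUE
          letI : MeasurableSpace (↥(UnitaryGroup.adelic (↥(maximalRealSubfield L)) L (IsCMField.complexConj L) 1
              (JW (↥(maximalRealSubfield L)) L a')) ⧸
                (UnitaryGroup.toAdelic (↥(maximalRealSubfield L)) L (IsCMField.complexConj L) 1 (JW (↥(maximalRealSubfield L)) L a')).range) :=
            borel _
          haveI := normal_range_toAdelic_JW L a'
          ∀ (hρ : HasThetaMajorants fun
              (p : ↥(UnitaryGroup.adelic (↥(maximalRealSubfield L)) L (IsCMField.complexConj L) 2 (Matrix.diagonal dV)) ×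
                ↥(UnitaryGroup.adelic (↥(maximalRealSubfield L)) L (IsCMField.complexConj L) 1 (JW (↥(maximalRealSubfield L)) L a')))
              (Φ : piSchwartzBruhat (↥(maximalRealSubfield L)) (Fin n')) =>
                pairRep (↥(maximalRealSubfield L)) L (IsCMField.complexConj L) 2 1 e₁ (Matrix.diagonal dV) (JW (↥(maximalRealSubfield L)) L a')
                  (chiSplittingLine L e₁ dV hdV hdV0 (toHeckeCharacter L lam) (isUnitary_toHeckeCharacter L lam)
                    ((isOscillatorChar_toHeckeCharacter_iff lam).mpr hlam) (TW (↥(maximalRealSubfield L)) a')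
                    (isUnit_det_TW (↥(maximalRealSubfield L)) a') (JW (↥(maximalRealSubfield L)) L a') (JW_eq (↥(maximalRealSubfield L)) L a'))
                  p Φ)
            (μW : Measure (↥(UnitaryGroup.adelic (↥(maximalRealSubfield L)) L (IsCMField.complexConj L) 1
              (JW (↥(maximalRealSubfield L)) L a')) ⧸
                (UnitaryGroup.toAdelic (↥(maximalRealSubfield L)) L (IsCMField.complexConj L) 1 (JW (↥(maximalRealSubfield L)) L a')).range))
            (_ : IsFiniteMeasure μW)
            (_ : SMulInvariantMeasure
              (↥(UnitaryGroup.adelic (↥(maximalRealSubfield L)) L (IsCMField.complexConj L) 1 (JW (↥(maximalRealSubfield L)) L a')))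
              (↥(UnitaryGroup.adelic (↥(maximalRealSubfield L)) L (IsCMField.complexConj L) 1 (JW (↥(maximalRealSubfield L)) L a')) ⧸
                (UnitaryGroup.toAdelic (↥(maximalRealSubfield L)) L (IsCMField.complexConj L) 1 (JW (↥(maximalRealSubfield L)) L a')).range)
              μW)
            (Ψ : piSchwartzBruhat (↥(maximalRealSubfield L)) (Fin n'))
            (hθ : MemLp (toQuotFun (adelicGroupData (↥(maximalRealSubfield L)) L (IsCMField.complexConj L) 2 H) fun x =>
              (lineThetaKernelDatum L 2 e₁ dV hdV hdV0 lam hlam a' hρ).thetaLiftFun μW Ψ (charCM ξ) (ιA x)) 2 μ),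
            MemLp.toLp _ hθ ∈ P.space.toSubmodule) ∧
        ( -- `CharSeam₂ L H e₁ dV hdV hdV0 P lam hlam a' ιA ξ` BY VALUE
          letI : MeasurableSpace (↥(UnitaryGroup.adelic (↥(maximalRealSubfield L)) L (IsCMField.complexConj L) 1
              (JW (↥(maximalRealSubfield L)) L a')) ⧸
                (UnitaryGroup.toAdelic (↥(maximalRealSubfield L)) L (IsCMField.complexConj L) 1 (JW (↥(maximalRealSubfield L)) L a')).range) :=
            borel _
          haveI := normal_range_toAdelic_JW L a'
          ∃ (hρ : HasThetaMajorants fun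
              (p : ↥(UnitaryGroup.adelic (↥(maximalRealSubfield L)) L (IsCMField.complexConj L) 2 (Matrix.diagonal dV)) ×
                ↥(UnitaryGroup.adelic (↥(maximalRealSubfield L)) L (IsCMField.complexConj L) 1 (JW (↥(maximalRealSubfield L)) L a')))
              (Φ : piSchwartzBruhat (↥(maximalRealSubfield L)) (Fin n')) =>
                pairRep (↥(maximalRealSubfield L)) L (IsCMField.complexConj L) 2 1 e₁ (Matrix.diagonal dV) (JW (↥(maximalRealSubfield L)) L a')
                  (chiSplittingLine L e₁ dV hdV hdV0 (toHeckeCharacter L lam) (isUnitary_toHeckeCharacter L lam)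
                    ((isOscillatorChar_toHeckeCharacter_iff lam).mpr hlam) (TW (↥(maximalRealSubfield L)) a')
                    (isUnit_det_TW (↥(maximalRealSubfield L)) a') (JW (↥(maximalRealSubfield L)) L a') (JW_eq (↥(maximalRealSubfield L)) L a'))
                  p Φ)
            (μW : Measure (↥(UnitaryGroup.adelic (↥(maximalRealSubfield L)) L (IsCMField.complexConj L) 1
              (JW (↥(maximalRealSubfield L)) L a')) ⧸
                (UnitaryGroup.toAdelic (↥(maximalRealSubfield L)) L (IsCMField.complexConj L) 1 (JW (↥(maximalRealSubfield L)) L a')).range))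
            (_ : IsFiniteMeasure μW)
            (_ : SMulInvariantMeasure
              (↥(UnitaryGroup.adelic (↥(maximalRealSubfield L)) L (IsCMField.complexConj L) 1 (JW (↥(maximalRealSubfield L)) L a')))
              (↥(UnitaryGroup.adelic (↥(maximalRealSubfield L)) L (IsCMField.complexConj L) 1 (JW (↥(maximalRealSubfield L)) L a')) ⧸
                (UnitaryGroup.toAdelic (↥(maximalRealSubfield L)) L (IsCMField.complexConj L) 1 (JW (↥(maximalRealSubfield L)) L a')).range)
              μW)
            (Ψ : piSchwartzBruhat (↥(maximalRealSubfield L)) (Fin n'))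
            (hθ : MemLp (toQuotFun (adelicGroupData (↥(maximalRealSubfield L)) L (IsCMField.complexConj L) 2 H) fun x =>
              (lineThetaKernelDatum L 2 e₁ dV hdV hdV0 lam hlam a' hρ).thetaLiftFun μW Ψ (charCM ξ) (ιA x)) 2 μ),
            MemLp.toLp _ hθ ∈ P.space.toSubmodule ∧ MemLp.toLp _ hθ ≠ 0) := by
  intro L _ _ _ ι H dV hdV hdV0 t ht g hg hsig hdef h4 μ _ n' e₁ lam hlam hw ιA hιA _ P a' hmeet
  -- `[U(H)]` is compact: `H` is definite at a complex place off `ι` (as in ★ `thetaCharRigid₂_of_irred`)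
  obtain ⟨τ, hτ⟩ := UnitaryGroup.exists_infinitePlace_ne L h4 ι
  haveI := UnitaryGroup.compactSpace_adelicGroupData_automorphicQuotient L 2 H
    (S1BettiSliceExclusion.anisotropic_of_formCongr_posDef L H t g dV hg τ (hdef τ hτ))
  -- (I-B): the character `ξ` with a non-zero `ξ`-theta class in `P`
  obtain ⟨ξ, hseam⟩ := F0LD1CharSeamOfMeets.charSeam_of_meets L 2 H e₁ dV hdV hdV0 t ht g hg ιA hιA P lam hlam a' hmeet
  refine ⟨ξ, ?_, hseam⟩
  obtain ⟨hρ, μW, hfin, hinv, Ψ, hθ, hmem, hne⟩ := hseam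
  rcases hα L ι H dV hdV hdV0 t ht g hg hsig hdef h4 μ e₁ lam hlam hw ιA hιA a' ξ P.space with hle | hbot
  · intro hρ' μW' hfin' hinv' Ψ' hθ'
    exact hle (Submodule.subset_span ⟨hρ', μW', hfin', hinv', Ψ', hθ', rfl⟩)
  · exfalso
    apply hne
    have hv : MemLp.toLp _ hθ ∈ Submodule.span ℂ (lineThetaClassSet L 2 H e₁ dV hdV hdV0 ιA μ lam hlam a' ξ) ⊓ P.space.toSubmodule :=
      Submodule.mem_inf.2 ⟨Submodule.subset_span ⟨hρ, μW, hfin, hinv, Ψ, hθ, rfl⟩, hmem⟩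
    rw [hbot] at hv
    exact (Submodule.mem_bot ℂ).1 hv

end Summit.HodgeConjecture.HodgeConjecture.Cruxes.HLiu418.F0LD1ThetaCharRigidOfDichotomy

end
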